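import Literature.Computability.AlgebraicComplexity.CohnUmansAlphaGammaBound
import Literature.Computability.AlgebraicComplexity.PseudoExponentBounds
import HarnessLib

/-!
# Cohn–Umans 2003, Cor. 4.3: a family with `α → 2` and `α − 2 = o(γ − 2)` proves `ω = 2`

Topic `Literature/Computability/AlgebraicComplexity` (group-theoretic matrix multiplication), namespace
`Literature.Computability.AlgebraicComplexity`; the limiting form of Cor. 4.2 (`CohnUmansAlphaGammaBound.lean`).

H. Cohn, C. Umans, *A group-theoretic approach to fast matrix multiplication*, FOCS 2003 = arXiv:math/0307321, §4
(p. 6 of the held text): "**Corollary 4.3** (Corollary 9 of the arXiv text). Suppose there exists a family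
`G₁, G₂, …` of finite groups such that `α(Gᵢ) = 2 + o(1)` as `i → ∞`, and furthermore `α(Gᵢ) − 2 = o(γ(Gᵢ) − 2)`.
Then the exponent of matrix multiplication is `2`."  (From Cor. 4.2: `ω ≤ α(γ−2)/(γ−α) = α / (1 − (α−2)/(γ−2))`.)

Lean form (`CohnUmans2003_cor43`): a sequence of finite groups `G i` realizing `⟨n i, m i, p i⟩` with degree bounds
`2 ≤ d i`, `d i ≥ max character degree`, `(d i)³ < n i·m i·p i`; with `αᵢ = 3 log|Gᵢ| / log(nᵢmᵢpᵢ)` and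
`γᵢ = log|Gᵢ| / log dᵢ` (the pseudo-exponent-type and `γ`-type values of this data), if `αᵢ → 2` and
`(αᵢ − 2)/(γᵢ − 2) → 0` then `omega ℂ = 2`.

## References
* H. Cohn, C. Umans, FOCS 2003, 438–449; arXiv:math/0307321, §4, Cor. 4.3 (Cor. 9 of the arXiv text, p. 6).
  [CohnUmans2003]
-/

noncomputable section

namespace Literature.Computability.AlgebraicComplexity

open Filter Topology Literature.RepresentationTheory.FiniteGroups

/-- **Cohn–Umans 2003, Cor. 4.3**: "Suppose there exists a family `G₁, G₂, …` of finite groups such that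
`α(Gᵢ) = 2 + o(1)` as `i → ∞`, and furthermore `α(Gᵢ) − 2 = o(γ(Gᵢ) − 2)`. Then the exponent of matrix
multiplication is `2`" — for the per-triple values `αᵢ = 3 log|Gᵢ|/log(nᵢmᵢpᵢ)`, `γᵢ = log|Gᵢ|/log dᵢ` of realized
triples and degree bounds (`ω ≤ αᵢ/(1 − (αᵢ−2)/(γᵢ−2))` by Cor. 4.2, and the right-hand side tends to `2`).
[cite: CohnUmans2003, Cor. 4.3 (Cor. 9 of the arXiv text, p. 6)] -/
theorem CohnUmans2003_cor43 (G : ℕ → Type) [∀ i, Group (G i)] [∀ i, Finite (G i)] (n m p d : ℕ → ℕ)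
    (h : ∀ i, RealizesTPP (G i) (n i) (m i) (p i)) (hd : ∀ i, maxCharDegree (G i) ≤ d i)
    (hd2 : ∀ i, 2 ≤ d i) (hlt : ∀ i, d i ^ 3 < n i * m i * p i)
    (hα : Tendsto (fun i => 3 * Real.log (Nat.card (G i)) / Real.log ((n i * m i * p i : ℕ) : ℝ)) atTop (𝓝 2))
    (ho : Tendsto (fun i => (3 * Real.log (Nat.card (G i)) / Real.log ((n i * m i * p i : ℕ) : ℝ) - 2) /
        (Real.log (Nat.card (G i)) / Real.log (d i) - 2)) atTop (𝓝 0)) :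
    omega ℂ = 2 := by
  -- abbreviations
  set α : ℕ → ℝ := fun i => 3 * Real.log (Nat.card (G i)) / Real.log ((n i * m i * p i : ℕ) : ℝ) with hαdef
  set γ : ℕ → ℝ := fun i => Real.log (Nat.card (G i)) / Real.log (d i) with hγdef
  -- Cor. 4.2 for each `i`, rewritten as `ω ≤ αᵢ / (1 − rᵢ)`
  have hbound : ∀ i, omega ℂ ≤ α i / (1 - (α i - 2) / (γ i - 2)) := by
    intro i
    obtain ⟨hαγ, hω⟩ := CohnUmans2003_cor42_alpha_gamma (h i) (hd i) (hd2 i) (hlt i) (α := α i) (γ := γ i)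
      rfl rfl
    -- `αᵢ > 2` (Lemma 3.1), hence `γᵢ > 2`
    haveI := Fintype.ofFinite (G i)
    have hN1 : 1 < n i * m i * p i :=
      lt_of_lt_of_le (by nlinarith [hd2 i, Nat.le_self_pow three_ne_zero (d i)]) (hlt i).le
    have hNpos : 0 < Real.log ((n i * m i * p i : ℕ) : ℝ) :=
      Real.log_pos (by exact_mod_cast hN1)
    have h31 := CohnUmans2003_lemma31_log (h i) hN1
    rw [← Nat.card_eq_fintype_card] at h31
    have hα2 : 2 < α i := by
      simp only [hαdef]
      rw [lt_div_iff₀ hNpos]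
      linarith
    have hγ2 : 2 < γ i := hα2.trans hαγ
    have h1 : γ i - 2 ≠ 0 := by linarith
    have e1 : 1 - (α i - 2) / (γ i - 2) = (γ i - α i) / (γ i - 2) := by
      field_simp
      ring
    calc omega ℂ ≤ α i * ((γ i - 2) / (γ i - α i)) := hω
      _ = α i / ((γ i - α i) / (γ i - 2)) := by rw [div_div_eq_mul_div, mul_div_assoc]
      _ = α i / (1 - (α i - 2) / (γ i - 2)) := by rw [e1]
  -- the right-hand side tends to `2 / (1 − 0) = 2`
  have hlim : Tendsto (fun i => α i / (1 - (α i - 2) / (γ i - 2))) atTop (𝓝 2) := by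
    have h1 : Tendsto (fun i => 1 - (α i - 2) / (γ i - 2)) atTop (𝓝 (1 - 0)) :=
      tendsto_const_nhds.sub ho
    have := hα.div h1 (by norm_num)
    rw [sub_zero, div_one] at this
    exact this
  exact le_antisymm (ge_of_tendsto' hlim hbound) (omega_two_le ℂ)

end Literature.Computability.AlgebraicComplexity

end
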